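import Literature.LinearAlgebra.RootSystem.AffineWeylGroupPoincareSeries
import Literature.LinearAlgebra.RootSystem.FundamentalWeights
import HarnessLib

/-!
# The Poincaré series of the EXTENDED affine Weyl group: `Ŵ_a(t) = W(t) · Σ_{d ∈ P(Φ)} t^{μ(d)}` (Iwahori–Matsumoto 1965 §1.9–§1.10 for `DW`)

N. Iwahori, H. Matsumoto, *On some Bruhat decomposition and the structure of the Hecke rings of p-adic Chevalley groups*, Publ. Math. IHÉS
25 (1965) 5–48 [IwahoriMatsumoto1965] (held `paper:doi-10-1007-bf02684396`, PDF pp. 17–22 = journal pp. 252–257). §1.2 (p. 241): «We denote by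
`D` the group consisting of the translations of the form `T(d)`, `d ∈ P_r^⊥` … `D'` the subgroup of `D` consisting of the translations of the form
`T(d)`, `d ∈ P^⊥` … `D/D' ≅ P/P_r`»; so IM's `DW` is the EXTENDED group (translations by the lattice dual to the root lattice) and `D'W` the affine
Weyl group proper. §1.9 Proposition 1.23 (p. 252): «Let `d ∈ P_r^⊥`, `w ∈ W`. `λ(T(d)w) = Σ_{α∈Δ⁺, w⁻¹(α)>0} |(α, d)| + Σ_{α∈Δ⁺, w⁻¹(α)<0}
|(α, d) - 1|`»; Proposition 1.25 (pp. 253–254): «`Min_{w∈W} λ(T(d)w)` is attained by one and only one element `w = w**` and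
`Min_{w∈W} λ(T(d)w) = λ(T(d)w**) = Σ_{α∈Δ₁} |(α,d)| + Σ_{α∈Δ₂} (|(α,d)| - 1)` … for any `w ∈ W`, `λ(T(d)w**w) = λ(T(d)w**) + n(w)`».
§1.10 (pp. 255–257): «a few comments about the Poincaré series `P(DW, t)`, `P(D'W, t)` will be given, where `P(DW, t) = Σ_{σ∈DW} t^{λ(σ)}` …
Now let `d ∈ P_r^⊥`, `w ∈ W`. We shall say that `d` is related to `w` if `Min λ(σ)` for `σ ∈ T(d)W` is attained by `T(d)w` … Since `DW` is a
disjoint union of the subsets `Θ'(w)W`, where `Θ'(w) = {T(d)w ; d ∈ Θ(w)}` (`w ∈ W`) (see Prop. 1.25), we get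
`P(DW, t) = Σ_{w∈W} Σ_{σ∈Θ'(w)W} t^{λ(σ)}`. Now `Σ_{σ∈Θ'(w)W} t^{λ(σ)} = Σ_{τ∈Θ'(w)} Σ_{w'∈W} t^{λ(τw')} = P(W, t) Σ_{τ∈Θ'(w)} t^{λ(τ)}` (see
Prop. 1.25), where `P(W, t) = Σ_{w'∈W} t^{n(w')}`.»
J. E. Humphreys, *Reflection Groups and Coxeter Groups* (1990) [Humphreys1990], §4.5 (the number of hyperplanes separating `A∘` from `wA∘`),
§8.9 (pp. 179–180): «the Poincaré series of `L(Φ^∨)` (viewed as a subgroup of the affine Weyl group `W_a`) … `W` is a parabolic subgroup `W_I` of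
`W_a` … so we can obtain the Poincaré series `W_a(t)` by multiplying the two series together as in 5.12».

THIS FILE (lane `lit-hodgefound`, prover seat p40, generation 47, row g47-#8; THEOREMS ONLY — no definition, instance, notation or named fact; net
debt 0) does for the EXTENDED group `Ŵ_a = DW` (translations by the weight lattice `P(Φ)`, CONVENTIONS of the `AffineWeylGroup*` files: `Ŵ_a` acts
on `M`, hyperplanes `⟨x, α^∨⟩ = k`, IM's `(α, d)` is `⟨d, α^∨⟩`) what row g47-#3 (`AffineWeylGroupPoincareSeries`) did for the Coxeter group
`W_a = D'W` through the parabolic factorisation `W_a = W^I·W_I`: `Ŵ_a` is not a Coxeter group, so here the factorisation is IM's own — every `σ ∈ Ŵ_a`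
is uniquely `T(d)·w**_d·w` with `d = σ(0) ∈ P(Φ)`, `w**_d ∈ W` the minimiser of Proposition 1.25 and `w ∈ W`, and then `λ(σ) = μ(d) + n(w)`.
Throughout, for integer levels `m = (m_α)` (`m_α = ⟨d, α^∨⟩`) and `g ∈ Aut P`:
`F_m(g) := Σ_{α≻0} (if g⁻¹α ≻ 0 then |m_α| else |m_α - 1|)` (Proposition 1.23's value of `λ(T(d)g)`, row g45-#4
`card_separating_constVAdd_mul_affineHom_eq` for `d ∈ P(Φ)`), `μ(m) := Σ_{α≻0} (if m_α ≤ 0 then |m_α| else |m_α| - 1)` (Proposition 1.25's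
minimum), `n(g) := Card {α ≻ 0 | gα ≺ 0}` (`= ℓ_W(g)`, row g36-#5 `length_weylGroup_eq_card_filter`), and `λ(σ)` for `σ ∈ Ŵ_a` is HALF OF
`Σ_α |k_α - k∘_α|` where `σA∘ = alcove k`, `A∘ = alcove k∘` (the number of hyperplanes separating `A∘` from `σA∘`, as in row g47-#3 §5).

* §1 ★★ `sum_sep_eq_sum_min_add_card` (THE DEFECT FORMULA behind Proposition 1.25: for EVERY `g`,
  `F_m(g) = μ(m) + Card {α ≻ 0 | ¬(g⁻¹α ≻ 0 ↔ m_α ≤ 0)}` — so `F_m ≥ μ(m)` with equality exactly at the minimiser `w**`, row g45-#14).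
* §2 ★★★ `sum_sep_mul_eq_sum_min_add_card` («`λ(T(d)w**w) = λ(T(d)w**) + n(w)`» FOR `DW`, in floor data: if `g₀` is the minimiser,
  `∀ α ≻ 0, (g₀⁻¹α ≻ 0 ↔ m_α ≤ 0)`, then `F_m(g₀g) = μ(m) + Card {α ≻ 0 | g⁻¹α ≺ 0}` — by §1 and two halvings of symmetric sums, row g45-#4
  `sum_eq_two_mul_sum_filter_isPos`).
* §3 ★★ `finite_weightLattice_sum_min_eq` (for a root SYSTEM the lattice points `d ∈ P(Φ)` with `μ(d) = k` are finitely many: all levels are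
  bounded by `k + 1` and determine `d`, tree `eq_of_forall_coroot'_eq`).
* §4 ★★★ `ncard_extendedAffineWeylGroup_sep_eq_sum` («`P(DW, t) = P(W, t)·Σ_{τ∈Γ} t^{λ(τ)}`» with `Γ ↔ P(Φ)`, COEFFICIENTWISE:
  `Card {σ ∈ Ŵ_a | λ(σ) = n} = Σ_{j+k=n} Card {g ∈ W | ℓ_W(g) = j} · Card {d ∈ P(Φ) | μ(d) = k}` — the bijection `(d, g) ↦ T(d)·w**_d·g⁻¹`,
  `P(Φ) × W → Ŵ_a`, tree `exists_of_mem_extendedAffineWeylGroup` ∕ `constVAdd_mul_affineHom_injective`), ★★ `mk_ncard_extendedAffineWeylGroup_eq_mul`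
  (the same in `ℕ⟦t⟧`: `Ŵ_a(t) = W(t)·P̂(t)` with `P̂(t) := Σ_k Card {d ∈ P(Φ) | μ(d) = k} t^k` and `W(t)` the Poincaré series of any Coxeter system
  on `W` with the simple reflections `s_j`).
* §5 ★★ `ncard_weightLattice_sum_min_eq_mul` («`P(DW, t) = |Ω|·P(D'W, t)`» READ ON THE LATTICES: `Card {d ∈ P(Φ) | μ(d) = k} =
  |Ω| · Card {d ∈ Q | μ(d) = k}` — from §4, row g47-#3 (`Ŵ_a(t) = |Ω|·W_a(t)`, `W_a(t) = W(t)·Σ_{d∈Q} t^{μ(d)}`) by cancelling `W(t)`, whose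
  constant term is `1`, in `ℤ⟦t⟧`).

BY NAME, nothing restated: rows g45-#4 (`card_separating_constVAdd_mul_affineHom_eq`, `sum_eq_two_mul_sum_filter_isPos`,
`exists_coroot'_eq_intCast_of_mem_weightLattice`), g45-#14 (`exists_weylGroup_forall_isPos_inv_smul_iff_le`), g47-#3
(`mk_ncard_extendedAffineWeylGroup_eq_smul`, `poincareSeries_affineWeylGroup_eq_mul`, `coeff_poincareSeries_quotient_eq_ncard`), g36-#5
(`length_weylGroup_eq_card_filter`), `FundamentalWeights` (`eq_of_forall_coroot'_eq`), `WeylGroupFundamentalDomain` (`finite_weylGroup`), p13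
(`poincareSeries`, `coeff_poincareSeries_univ`, `length_simple_eq`).

## Scope caveats

Iwahori–Matsumoto's closed form (Proposition 1.30, `P(DW, t) = P(W, t) Σ_{w∈W} t^{a(w)-n(w)} / Π_i (1 - t^{a_i})`, through the cones `Θ(w)`)
is NOT derived here: this file stops at `Ŵ_a(t) = W(t)·Σ_{d∈P(Φ)} t^{μ(d)}`, its input. Finite reduced crystallographic root pairings over an
ordered field of characteristic zero; §3–§5 for root SYSTEMS (`[P.IsRootSystem]`: the levels determine the point), §4–§5 with `η`, `hη` (highest
co-root, so that `A∘` is the alcove `alcove k∘`), §5 with a Coxeter system `cs` on `W_a` whose simple reflections are the walls of `A∘` (row g45-#1)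
and one, `csW`, on `W` with the simple reflections `s_j`.

## References

* [IwahoriMatsumoto1965] N. Iwahori, H. Matsumoto, Publ. Math. IHÉS 25 (1965) 5–48, §1.2, §1.9 Propositions 1.23, 1.25, §1.10 (pp. 241, 252–257).
* [Humphreys1990] J. E. Humphreys, *Reflection Groups and Coxeter Groups*, CUP (1990), §4.5, §5.12, §8.9 (pp. 179–180).
-/

noncomputable section

open Module Set Function PowerSeries
open Literature.GroupTheory.Coxeter Literature.GroupTheory.Coxeter.PreCoxeterSystem

namespace Literature.LinearAlgebra.RootSystem

namespace Base

variable {ι K M N : Type*} [Field K] [LinearOrder K] [IsStrictOrderedRing K] [AddCommGroup M] [Module K M]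
  [AddCommGroup N] [Module K N] [Fintype ι] [DecidableEq ι]
  {P : RootPairing ι K M N} [CharZero K] [P.IsCrystallographic] [P.IsReduced] (b : P.Base)

/-! ## §0 Bookkeeping -/

section Aux

/-- The summand of `F_m(g)` is the summand of `μ(m)` plus `0` or `1`, according as `(g⁻¹α ≻ 0 ↔ m_α ≤ 0)` holds or not.
[cite: IwahoriMatsumoto1965, §1.9 proof of Proposition 1.25 ("we have |m| < |m - 1| if m ≤ 0, and |m| > |m - 1| if m > 0")] -/
private theorem summand_eq_add (m : ℤ) (p : Prop) [Decidable p] :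
    (if p then |m| else |m - 1|) = (if m ≤ 0 then |m| else |m| - 1) + (if (p ↔ m ≤ 0) then 0 else 1) := by
  by_cases hp : p <;> by_cases hm : m ≤ 0
  · rw [if_pos hp, if_pos hm, if_pos (iff_of_true hp hm), add_zero]
  · rw [if_pos hp, if_neg hm, if_neg (fun h ↦ hm (h.mp hp))]
    ring
  · rw [if_neg hp, if_pos hm, if_neg (fun h ↦ hp (h.mpr hm)), abs_of_nonpos hm, abs_of_nonpos (show m - 1 ≤ 0 by omega)]
    ring
  · rw [if_neg hp, if_neg hm, if_pos (iff_of_false hp hm), abs_of_nonneg (show (0 : ℤ) ≤ m - 1 by omega),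
      abs_of_nonneg (show (0 : ℤ) ≤ m by omega), add_zero]

/-- Each summand of `μ(m)` is nonnegative (`|m| - 1 ≥ 0` when `m > 0`). [cite: IwahoriMatsumoto1965, §1.9 Proposition 1.25] -/
private theorem summand_min_nonneg (m : ℤ) : (0 : ℤ) ≤ (if m ≤ 0 then |m| else |m| - 1) := by
  by_cases h : m ≤ 0
  · rw [if_pos h]; exact abs_nonneg _
  · rw [if_neg h, abs_of_nonneg (show (0 : ℤ) ≤ m by omega)]; omega

omit [LinearOrder K] [IsStrictOrderedRing K] [Fintype ι] [DecidableEq ι] [CharZero K] [P.IsCrystallographic] [P.IsReduced] in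
/-- An automorphism of `P` commutes with `α ↦ -α` on indices: `g(-α_i) = -(gα_i)`. [cite: IwahoriMatsumoto1965, §1.1 ("P, P_r are stable under W")] -/
private theorem smul_reflectionPerm_self (g : P.Aut) (i : ι) :
    g • P.reflectionPerm i i = P.reflectionPerm (g • i) (g • i) := by
  apply P.root.injective
  rw [smul_index_eq, smul_index_eq, RootPairing.Equiv.root_indexEquiv_eq_smul, RootPairing.root_reflectionPerm,
    RootPairing.root_reflectionPerm, RootPairing.reflection_apply_self, RootPairing.reflection_apply_self, smul_neg,
    RootPairing.Equiv.root_indexEquiv_eq_smul]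

omit [LinearOrder K] [IsStrictOrderedRing K] [Fintype ι] [DecidableEq ι] [CharZero K] [P.IsCrystallographic] [P.IsReduced] in
/-- `⟨x, (-α_i)^∨⟩ = -⟨x, α_i^∨⟩`. [cite: IwahoriMatsumoto1965, §1.9 ("(-α, d) = -(α, d)")] -/
private theorem coroot'_reflectionPerm_self_self_apply (i : ι) (x : M) : P.coroot' (P.reflectionPerm i i) x = -P.coroot' i x := by
  rw [RootPairing.coroot'_reflectionPerm, LinearMap.coe_comp, comp_apply, LinearEquiv.coe_coe, RootPairing.reflection_apply,
    map_sub, map_smul, RootPairing.root_coroot'_eq_pairing, RootPairing.pairing_same, smul_eq_mul]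
  ring

end Aux

/-! ## §1 The defect formula `F_m(g) = μ(m) + Card {α ≻ 0 | ¬(g⁻¹α ≻ 0 ↔ m_α ≤ 0)}` -/

section Defect

omit [LinearOrder K] [IsStrictOrderedRing K] [DecidableEq ι] [P.IsCrystallographic] [P.IsReduced] in
/-- ★★ **THE DEFECT FORMULA** (refining the bounds of Proposition 1.25): for every `g ∈ Aut P` and integer levels `m`,
`Σ_{α≻0} (if g⁻¹α ≻ 0 then |m_α| else |m_α - 1|) = Σ_{α≻0} (if m_α ≤ 0 then |m_α| else |m_α| - 1) + Card {α ≻ 0 | ¬(g⁻¹α ≻ 0 ↔ m_α ≤ 0)}`: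
root by root, «`|m| < |m - 1|` if `m ≤ 0` and `|m| > |m - 1|` if `m > 0`», the difference being exactly `1`; in particular `λ(T(d)g) ≥ μ(d)` with
equality iff `g⁻¹α ≻ 0 ↔ (α, d) ≤ 0` for all `α ≻ 0` (`g = w**`). [cite: IwahoriMatsumoto1965, §1.9 Proposition 1.25 and its proof (pp. 253–254)] -/
theorem sum_sep_eq_sum_min_add_card [DecidablePred b.IsPos] (m : ι → ℤ) (g : P.Aut) :
    ∑ i ∈ Finset.univ.filter b.IsPos, (if b.IsPos (g⁻¹ • i) then |m i| else |m i - 1|) =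
      ∑ i ∈ Finset.univ.filter b.IsPos, (if m i ≤ 0 then |m i| else |m i| - 1) +
        (((Finset.univ.filter b.IsPos).filter (fun i ↦ ¬ (b.IsPos (g⁻¹ • i) ↔ m i ≤ 0))).card : ℤ) := by
  rw [Finset.card_filter, Nat.cast_sum, ← Finset.sum_add_distrib]
  refine Finset.sum_congr rfl fun i _ ↦ ?_
  rw [summand_eq_add (m i) (b.IsPos (g⁻¹ • i))]
  congr 1
  by_cases h : (b.IsPos (g⁻¹ • i) ↔ m i ≤ 0)
  · rw [if_pos h, if_neg (not_not.mpr h), Nat.cast_zero]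
  · rw [if_neg h, if_pos h, Nat.cast_one]

omit [LinearOrder K] [IsStrictOrderedRing K] [DecidableEq ι] [P.IsCrystallographic] [P.IsReduced] in
/-- ★ Hence `μ(m) ≤ F_m(g)` for every `g` («`Min_{w∈W} λ(T(d)w) = Σ_{α∈Δ₁} |(α,d)| + Σ_{α∈Δ₂} (|(α,d)| - 1)`», the easy inequality, now for
arbitrary integer levels — i.e. for `d ∈ P(Φ)`, the group `DW`). [cite: IwahoriMatsumoto1965, §1.9 Proposition 1.25] -/
theorem sum_min_le_sum_sep [DecidablePred b.IsPos] (m : ι → ℤ) (g : P.Aut) :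
    ∑ i ∈ Finset.univ.filter b.IsPos, (if m i ≤ 0 then |m i| else |m i| - 1) ≤
      ∑ i ∈ Finset.univ.filter b.IsPos, (if b.IsPos (g⁻¹ • i) then |m i| else |m i - 1|) := by
  rw [sum_sep_eq_sum_min_add_card b m g]
  exact le_add_of_nonneg_right (Nat.cast_nonneg _)

omit [LinearOrder K] [IsStrictOrderedRing K] [DecidableEq ι] [P.IsCrystallographic] [P.IsReduced] in
/-- ★ … with EQUALITY `F_m(g) = μ(m)` iff `g⁻¹α ≻ 0 ↔ m_α ≤ 0` for every `α ≻ 0` («attained by one and only one element `w = w**`», the element with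
`w**Δ⁺ = -Θ`; existence and uniqueness of such `g ∈ W` are rows g45-#14 `exists_weylGroup_forall_isPos_inv_smul_iff_le`,
`weylGroup_unique_of_forall_isPos_inv_smul_iff`). [cite: IwahoriMatsumoto1965, §1.9 Proposition 1.25 ("is attained by one and only one element, i.e. by w = w**")] -/
theorem sum_sep_eq_sum_min_iff [DecidablePred b.IsPos] (m : ι → ℤ) (g : P.Aut) :
    ∑ i ∈ Finset.univ.filter b.IsPos, (if b.IsPos (g⁻¹ • i) then |m i| else |m i - 1|) =
        ∑ i ∈ Finset.univ.filter b.IsPos, (if m i ≤ 0 then |m i| else |m i| - 1) ↔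
      ∀ i, b.IsPos i → (b.IsPos (g⁻¹ • i) ↔ m i ≤ 0) := by
  rw [sum_sep_eq_sum_min_add_card b m g, add_eq_left, Nat.cast_eq_zero, Finset.card_eq_zero, Finset.filter_eq_empty_iff]
  simp only [Finset.mem_filter, Finset.mem_univ, true_and, not_not]

end Defect

/-! ## §2 «`λ(T(d)w**w) = λ(T(d)w**) + n(w)`» for `DW` -/

section MinimizerCoset

omit [LinearOrder K] [IsStrictOrderedRing K] [DecidableEq ι] [P.IsCrystallographic] [P.IsReduced] in
/-- ★★★ **«FOR ANY `w ∈ W`, `λ(T(d)w**w) = λ(T(d)w**) + n(w)`», FOR THE EXTENDED GROUP `DW` (floor data, arbitrary integer levels)**: if `g₀`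
is the minimiser (`g₀⁻¹α ≻ 0 ↔ m_α ≤ 0` for all `α ≻ 0`), then for every `g`,
`F_m(g₀g) = μ(m) + Card {α ≻ 0 | g⁻¹α ≺ 0}` (`= μ(m) + n(g⁻¹) = μ(m) + n(g)`). Proof: by §1 the defect of `g₀g` counts the `α ≻ 0` with
`¬(g⁻¹g₀⁻¹α ≻ 0 ↔ g₀⁻¹α ≻ 0)`; the indicator of `¬(g⁻¹β ≻ 0 ↔ β ≻ 0)` is invariant under `β ↦ -β`, so summing it over `β = g₀⁻¹α`, `α ≻ 0`
(one root from each pair `±β`) gives the same as summing over `β ≻ 0`. [cite: IwahoriMatsumoto1965, §1.9 Proposition 1.25 ("for any w ∈ W, λ(T(d)w**w) = λ(T(d)w**) + n(w)") and §1.10 ("Σ_{σ∈Θ′(w)W} t^{λ(σ)} = … = P(W, t) Σ_{τ∈Θ′(w)} t^{λ(τ)} (see Prop. 1.25)")] -/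
theorem sum_sep_mul_eq_sum_min_add_card [DecidablePred b.IsPos] (m : ι → ℤ) {g₀ : P.Aut}
    (h₀ : ∀ i, b.IsPos i → (b.IsPos (g₀⁻¹ • i) ↔ m i ≤ 0)) (g : P.Aut) :
    ∑ i ∈ Finset.univ.filter b.IsPos, (if b.IsPos ((g₀ * g)⁻¹ • i) then |m i| else |m i - 1|) =
      ∑ i ∈ Finset.univ.filter b.IsPos, (if m i ≤ 0 then |m i| else |m i| - 1) +
        (((Finset.univ.filter b.IsPos).filter (fun i ↦ ¬ b.IsPos (g⁻¹ • i))).card : ℤ) := by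
  rw [sum_sep_eq_sum_min_add_card b m (g₀ * g)]
  congr 1
  -- the symmetric indicator `G(β) = [¬(g⁻¹β ≻ 0 ↔ β ≻ 0)]`
  set G : ι → ℤ := fun j ↦ if (b.IsPos (g⁻¹ • j) ↔ b.IsPos j) then 0 else 1 with hG
  have hGsymm : ∀ j, G (P.reflectionPerm j j) = G j := by
    intro j
    have e1 : b.IsPos (P.reflectionPerm (g⁻¹ • j) (g⁻¹ • j)) ↔ ¬ b.IsPos (g⁻¹ • j) := RootPairing.Base.IsPos.neg_iff_not b _
    have e2 : b.IsPos (P.reflectionPerm j j) ↔ ¬ b.IsPos j := RootPairing.Base.IsPos.neg_iff_not b j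
    simp only [hG, smul_reflectionPerm_self]
    by_cases h : (b.IsPos (g⁻¹ • j) ↔ b.IsPos j)
    · rw [if_pos h, if_pos (e1.trans ((not_iff_not.mpr h).trans e2.symm))]
    · rw [if_neg h, if_neg (fun h' ↦ h (not_iff_not.mp ((e1.symm.trans h').trans e2)))]
  -- the defect of `g₀g` is `Σ_{α≻0} G(g₀⁻¹α)`
  have h1 : ((((Finset.univ.filter b.IsPos).filter (fun i ↦ ¬ (b.IsPos ((g₀ * g)⁻¹ • i) ↔ m i ≤ 0))).card : ℕ) : ℤ) =
      ∑ i ∈ Finset.univ.filter b.IsPos, G (g₀⁻¹ • i) := by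
    rw [Finset.card_filter, Nat.cast_sum]
    refine Finset.sum_congr rfl fun i hi ↦ ?_
    rw [Finset.mem_filter] at hi
    simp only [hG, mul_inv_rev, mul_smul]
    have e := h₀ i hi.2
    by_cases h : (b.IsPos (g⁻¹ • g₀⁻¹ • i) ↔ b.IsPos (g₀⁻¹ • i))
    · rw [if_neg (not_not.mpr (h.trans e)), if_pos h, Nat.cast_zero]
    · rw [if_pos (fun h' ↦ h (h'.trans e.symm)), if_neg h, Nat.cast_one]
  -- two halvings and a reindexing
  have h2 : ∑ i, G (g₀⁻¹ • i) = ∑ i, G i := Equiv.sum_comp (MulAction.toPerm (g₀⁻¹ : P.Aut)) G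
  have h3 : ∑ i, G (g₀⁻¹ • i) = 2 * ∑ i ∈ Finset.univ.filter b.IsPos, G (g₀⁻¹ • i) :=
    sum_eq_two_mul_sum_filter_isPos b _ fun i ↦ by simp only [smul_reflectionPerm_self, hGsymm]
  have h4 : ∑ i, G i = 2 * ∑ i ∈ Finset.univ.filter b.IsPos, G i := sum_eq_two_mul_sum_filter_isPos b G hGsymm
  have h5 : ∑ i ∈ Finset.univ.filter b.IsPos, G i = (((Finset.univ.filter b.IsPos).filter (fun i ↦ ¬ b.IsPos (g⁻¹ • i))).card : ℤ) := by
    rw [Finset.card_filter, Nat.cast_sum]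
    refine Finset.sum_congr rfl fun i hi ↦ ?_
    rw [Finset.mem_filter] at hi
    simp only [hG]
    by_cases h : b.IsPos (g⁻¹ • i)
    · rw [if_pos (iff_of_true h hi.2), if_neg (not_not.mpr h), Nat.cast_zero]
    · rw [if_neg (fun h' ↦ h (h'.mpr hi.2)), if_pos h, Nat.cast_one]
  rw [h1, ← h5]
  linarith

end MinimizerCoset

/-! ## §3 Finiteness: the lattice points `d ∈ P(Φ)` with `μ(d) = k` -/

section Finiteness

omit [LinearOrder K] [IsStrictOrderedRing K] [DecidableEq ι] [P.IsCrystallographic] [P.IsReduced] in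
/-- ★★ **FOR A ROOT SYSTEM, ONLY FINITELY MANY `d ∈ P(Φ)` HAVE `μ(d) = k`** (so the series `Σ_{d∈P(Φ)} t^{μ(d)}` has finite coefficients): each
summand of `μ` is `≥ |m_α| - 1 ≥ 0`, so `|⟨d, α^∨⟩| ≤ k + 1` for every root `α` (for `α ≺ 0` through `⟨d, (-α)^∨⟩ = -⟨d, α^∨⟩`), and `d` is
determined by its levels (`eq_of_forall_coroot'_eq`). [cite: IwahoriMatsumoto1965, §1.10 ("P(DW, t) = Σ_{σ∈DW} t^{λ(σ)}")] [cite: Humphreys1990, §8.9 ("the Poincaré series of L(Φ^∨) (viewed as a subgroup of the affine Weyl group)")] -/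
theorem finite_weightLattice_sum_min_eq [DecidablePred b.IsPos] [P.IsRootSystem] (k : ℤ) :
    {d : M | d ∈ weightLattice P ∧ ∃ m : ι → ℤ, (∀ i, P.coroot' i d = m i) ∧
      ∑ i ∈ Finset.univ.filter b.IsPos, (if m i ≤ 0 then |m i| else |m i| - 1) = k}.Finite := by
  refine Set.Finite.of_finite_image (f := fun d : M ↦ fun i : ι ↦ P.coroot' i d) ?_ ?_
  · refine (Set.Finite.pi' (fun _ : ι ↦ ((Set.finite_Icc (-(k + 1)) (k + 1)).image (Int.cast : ℤ → K)))).subset ?_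
    rintro v ⟨d, ⟨-, m, hm, hμ⟩, rfl⟩
    -- every summand of `μ` is nonnegative, so each is at most `k`
    have hterm : ∀ j ∈ Finset.univ.filter b.IsPos, (0 : ℤ) ≤ (if m j ≤ 0 then |m j| else |m j| - 1) :=
      fun j _ ↦ summand_min_nonneg (m j)
    have hbound : ∀ j, b.IsPos j → |m j| ≤ k + 1 := by
      intro j hj
      have h1 := Finset.single_le_sum hterm (Finset.mem_filter.mpr ⟨Finset.mem_univ _, hj⟩)
      rw [hμ] at h1
      by_cases h : m j ≤ 0
      · rw [if_pos h] at h1; linarith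
      · rw [if_neg h] at h1; linarith
    intro i
    refine ⟨m i, ?_, (hm i).symm⟩
    rw [Set.mem_Icc, ← abs_le]
    by_cases hi : b.IsPos i
    · exact hbound i hi
    · have hneg : b.IsPos (P.reflectionPerm i i) := (RootPairing.Base.IsPos.neg_iff_not b i).mpr hi
      have hmi : m (P.reflectionPerm i i) = -m i := by
        have h1 := hm (P.reflectionPerm i i)
        rw [coroot'_reflectionPerm_self_self_apply, hm i] at h1
        exact_mod_cast h1.symm
      have h1 := hbound _ hneg
      rwa [hmi, abs_neg] at h1
  · intro d _ d' _ h
    exact eq_of_forall_coroot'_eq b fun j _ ↦ congr_fun h j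

end Finiteness

/-! ## §4 «`P(DW, t) = P(W, t)·Σ_{τ∈Γ} t^{λ(τ)}`»: `Ŵ_a(t) = W(t) · Σ_{d∈P(Φ)} t^{μ(d)}` -/

section ExtendedSeries

variable [Nonempty ι] [DecidablePred b.IsPos] [P.IsRootSystem] {η : ι}
  (hη : ∀ k, P.coroot η - P.coroot k ∈ AddSubmonoid.closure (P.coroot '' (b.support : Set ι)))

include hη

/-- ★★★ **IWAHORI–MATSUMOTO §1.10 FOR THE EXTENDED GROUP, COEFFICIENTWISE: `Card {σ ∈ Ŵ_a | λ(σ) = n} = Σ_{j+k=n} Card {g ∈ W | ℓ_W(g) = j} ·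
Card {d ∈ P(Φ) | μ(d) = k}`** — «since `DW` is a disjoint union of the subsets `Θ'(w)W` … `P(DW, t) = Σ_{w∈W} Σ_{σ∈Θ'(w)W} t^{λ(σ)}` … `= P(W, t)
Σ_{τ∈Θ'(w)} t^{λ(τ)}` (see Prop. 1.25)»: every `σ ∈ Ŵ_a` is `T(d)·w**_d·g⁻¹` for a unique pair `(d, g) ∈ P(Φ) × W` (`d = σ(0)`, `w**_d` the
minimiser of Proposition 1.25, rows g44 `exists_of_mem_extendedAffineWeylGroup`, `constVAdd_mul_affineHom_injective`, g45-#14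
`exists_weylGroup_forall_isPos_inv_smul_iff_le`), and then `λ(σ) = μ(d) + n(g)` (§2 with row g45-#4 `card_separating_constVAdd_mul_affineHom_eq` and
row g36-#5 `ℓ_W = n`); the pieces are finite by §3 and `finite_weylGroup`. Here `λ(σ) = n` is `Σ_α |k_α - k∘_α| = 2n` for `σA∘ = alcove k`, and
`ℓ_W` is the word length in the simple reflections `s_j`, `j ∈ Δ`. [cite: IwahoriMatsumoto1965, §1.10 ("P(DW, t) = Σ_{w∈W} Σ_{σ∈Θ′(w)W} t^{λ(σ)} … = P(W, t) Σ_{τ∈Θ′(w)} t^{λ(τ)} (see Prop. 1.25)")] [cite: Humphreys1990, §8.9 ("we can obtain the Poincaré series W_a(t) by multiplying the two series together as in 5.12")] -/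
theorem ncard_extendedAffineWeylGroup_sep_eq_sum (n : ℕ) :
    {σ : M ≃ᵃ[K] M | σ ∈ extendedAffineWeylGroup P ∧ ∃ k : ι → ℤ,
        σ '' {x : M | ∀ i, b.IsPos i → 0 < P.coroot' i x ∧ P.coroot' i x < 1} = alcove P k ∧
          ∑ i, |k i - (if b.IsPos i then (0 : ℤ) else -1)| = 2 * n}.ncard =
      ∑ p ∈ Finset.antidiagonal n,
        {g : P.weylGroup | PreCoxeterSystem.length (fun j : b.support ↦ RootPairing.weylGroup.ofIdx P (j : ι)) g = p.1}.ncard *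
          {d : M | d ∈ weightLattice P ∧ ∃ m : ι → ℤ, (∀ i, P.coroot' i d = m i) ∧
            ∑ i ∈ Finset.univ.filter b.IsPos, (if m i ≤ 0 then |m i| else |m i| - 1) = p.2}.ncard := by
  classical
  -- levels `m d` and minimisers `g₀ d`, as functions of `d ∈ P(Φ)`
  have hlev : ∀ d : M, d ∈ weightLattice P → ∃ m : ι → ℤ, ∃ g₀ : P.Aut, (∀ i, P.coroot' i d = m i) ∧ g₀ ∈ P.weylGroup ∧
      ∀ i, b.IsPos i → (b.IsPos (g₀⁻¹ • i) ↔ m i ≤ 0) := by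
    intro d hd
    obtain ⟨m, hm, -⟩ := exists_coroot'_eq_intCast_of_mem_weightLattice hd
    obtain ⟨g₀, hg₀, h₀⟩ := exists_weylGroup_forall_isPos_inv_smul_iff_le b hη hm
    exact ⟨m, g₀, hm, hg₀, h₀⟩
  choose! m g₀ hm hg₀W h₀ using hlev
  -- opaque abbreviations `μ d`, `ℓW g`, the set `A∘`
  obtain ⟨μ, hμ⟩ : ∃ μ : M → ℤ, ∀ d, μ d = ∑ i ∈ Finset.univ.filter b.IsPos, (if m d i ≤ 0 then |m d i| else |m d i| - 1) :=
    ⟨_, fun _ ↦ rfl⟩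
  obtain ⟨ℓW, hℓW⟩ : ∃ ℓW : P.weylGroup → ℕ, ∀ g, ℓW g = PreCoxeterSystem.length (fun j : b.support ↦ RootPairing.weylGroup.ofIdx P (j : ι)) g :=
    ⟨_, fun _ ↦ rfl⟩
  obtain ⟨A, hA⟩ : ∃ A : Set M, A = {x : M | ∀ i, b.IsPos i → 0 < P.coroot' i x ∧ P.coroot' i x < 1} := ⟨_, rfl⟩
  have hμnn : ∀ d, 0 ≤ μ d := fun d ↦ by rw [hμ]; exact Finset.sum_nonneg fun j _ ↦ summand_min_nonneg (m d j)
  -- the levels are unique, so the lattice set of the statement is `{d ∈ P(Φ) | μ d = k}`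
  have hmuniq : ∀ d, d ∈ weightLattice P → ∀ m' : ι → ℤ, (∀ i, P.coroot' i d = m' i) → m' = m d := fun d hd m' hm' ↦
    funext fun i ↦ by have h1 := (hm' i).symm.trans (hm d hd i); exact_mod_cast h1
  have hB : ∀ k : ℤ, {d : M | d ∈ weightLattice P ∧ ∃ m : ι → ℤ, (∀ i, P.coroot' i d = m i) ∧
      ∑ i ∈ Finset.univ.filter b.IsPos, (if m i ≤ 0 then |m i| else |m i| - 1) = k} = {d : M | d ∈ weightLattice P ∧ μ d = k} := by
    intro k
    ext d
    simp only [Set.mem_setOf_eq]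
    refine ⟨fun ⟨hd, m', hm', hk⟩ ↦ ⟨hd, ?_⟩, fun ⟨hd, hk⟩ ↦ ⟨hd, m d, hm d hd, by rw [← hμ]; exact hk⟩⟩
    rw [hmuniq d hd m' hm'] at hk
    rw [hμ]
    exact hk
  have hW : ∀ j : ℕ, {g : P.weylGroup | PreCoxeterSystem.length (fun j : b.support ↦ RootPairing.weylGroup.ofIdx P (j : ι)) g = j} =
      {g : P.weylGroup | ℓW g = j} := fun j ↦ by simp only [hℓW]
  -- the length of `T(d)·g₀(d)·g⁻¹` is `μ d + ℓ_W(g)`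
  have hlen : ∀ d, d ∈ weightLattice P → ∀ g : P.weylGroup, ∀ k : ι → ℤ,
      ⇑(AffineEquiv.constVAdd K M d * affineHom P (g₀ d * (g : P.Aut)⁻¹)) '' A = alcove P k →
        ∑ i, |k i - (if b.IsPos i then (0 : ℤ) else -1)| = 2 * (μ d + ℓW g) := by
    intro d hd g k hk
    rw [hA] at hk
    rw [card_separating_constVAdd_mul_affineHom_eq b hη _ hd (hm d hd) hk, sum_sep_mul_eq_sum_min_add_card b (m d) (h₀ d hd), hμ, hℓW,
      length_weylGroup_eq_card_filter b g]
    simp only [inv_inv]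
  -- the parametrisation `Ψ(d, g) = T(d)·g₀(d)·g⁻¹` of `Ŵ_a` by `P(Φ) × W`
  obtain ⟨Ψ, hΨ⟩ : ∃ Ψ : M × P.weylGroup → (M ≃ᵃ[K] M),
      ∀ q, Ψ q = AffineEquiv.constVAdd K M q.1 * affineHom P (g₀ q.1 * (q.2 : P.Aut)⁻¹) := ⟨_, fun _ ↦ rfl⟩
  have hinj : Set.InjOn Ψ {q | q.1 ∈ weightLattice P} := by
    rintro ⟨d, g⟩ - ⟨d', g'⟩ - h
    rw [hΨ, hΨ] at h
    have h' := constVAdd_mul_affineHom_injective P (a₁ := (d, g₀ d * (g : P.Aut)⁻¹)) (a₂ := (d', g₀ d' * (g' : P.Aut)⁻¹)) h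
    simp only [Prod.mk.injEq] at h'
    obtain ⟨rfl, h2⟩ := h'
    rw [mul_right_inj, inv_inj] at h2
    exact Prod.ext rfl (Subtype.ext h2)
  have himage : Ψ '' {q | q.1 ∈ weightLattice P ∧ μ q.1 + ℓW q.2 = n} =
      {σ : M ≃ᵃ[K] M | σ ∈ extendedAffineWeylGroup P ∧ ∃ k : ι → ℤ, σ '' A = alcove P k ∧
        ∑ i, |k i - (if b.IsPos i then (0 : ℤ) else -1)| = 2 * n} := by
    ext σ
    simp only [Set.mem_image, Set.mem_setOf_eq, Prod.exists]
    constructor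
    · rintro ⟨d, g, ⟨hd, hn⟩, rfl⟩
      have hmem : Ψ (d, g) ∈ extendedAffineWeylGroup P := by
        rw [hΨ]
        exact mul_mem (constVAdd_mem_extendedAffineWeylGroup P hd)
          (affineHom_mem_extendedAffineWeylGroup P (mul_mem (hg₀W d hd) (inv_mem g.2)))
      obtain ⟨k, hk⟩ := exists_image_eq_alcove_of_mem_extendedAffineWeylGroup hmem (fun i ↦ if b.IsPos i then (0 : ℤ) else -1)
      rw [← fundamentalAlcove_eq_alcove b, ← hA] at hk
      refine ⟨hmem, k, hk, ?_⟩
      rw [hΨ] at hk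
      rw [hlen d hd g k hk, hn]
    · rintro ⟨hσ, k, hk, hkn⟩
      obtain ⟨d, hd, h, hh, rfl⟩ := exists_of_mem_extendedAffineWeylGroup P hσ
      have hg : h⁻¹ * g₀ d ∈ P.weylGroup := mul_mem (inv_mem hh) (hg₀W d hd)
      have heq : g₀ d * ((⟨h⁻¹ * g₀ d, hg⟩ : P.weylGroup) : P.Aut)⁻¹ = h := by
        rw [Subgroup.coe_mk, mul_inv_rev, inv_inv, mul_inv_cancel_left]
      refine ⟨d, ⟨h⁻¹ * g₀ d, hg⟩, ⟨hd, ?_⟩, by rw [hΨ, heq]⟩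
      have h1 := hlen d hd ⟨h⁻¹ * g₀ d, hg⟩ k (by rw [heq]; exact hk)
      rw [hkn] at h1
      linarith
  -- finiteness of the pieces
  haveI : Finite P.weylGroup := finite_weylGroup b
  have hBfin : ∀ k : ℤ, ({d : M | d ∈ weightLattice P ∧ μ d = k}).Finite := fun k ↦ by
    rw [← hB k]
    exact finite_weightLattice_sum_min_eq b k
  have hAfin : ∀ j : ℕ, ({g : P.weylGroup | ℓW g = j}).Finite := fun j ↦ Set.toFinite _
  -- the parameter set is a disjoint union of products
  have hTeq : {q : M × P.weylGroup | q.1 ∈ weightLattice P ∧ μ q.1 + ℓW q.2 = n} =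
      ↑((Finset.antidiagonal n).biUnion fun p ↦ (hBfin (p.2 : ℤ)).toFinset ×ˢ (hAfin p.1).toFinset) := by
    ext ⟨d, g⟩
    simp only [Set.mem_setOf_eq, Finset.coe_biUnion, Finset.mem_coe, Set.mem_iUnion, Finset.coe_product, Set.mem_prod,
      Set.Finite.coe_toFinset, Finset.mem_antidiagonal, exists_prop, Prod.exists]
    constructor
    · rintro ⟨hd, hn⟩
      refine ⟨ℓW g, (μ d).toNat, by have := Int.toNat_of_nonneg (hμnn d); omega, ⟨hd, (Int.toNat_of_nonneg (hμnn d)).symm⟩, rfl⟩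
    · rintro ⟨j, k, hjk, ⟨hd, hk⟩, hj⟩
      refine ⟨hd, ?_⟩
      rw [hk, hj]
      omega
  rw [← hA, ← himage, (hinj.mono fun q hq ↦ hq.1).ncard_image, hTeq, Set.ncard_coe_finset, Finset.card_biUnion]
  · refine Finset.sum_congr rfl fun p _ ↦ ?_
    rw [Finset.card_product, hB, hW, ← Set.ncard_eq_toFinset_card _ (hBfin p.2), ← Set.ncard_eq_toFinset_card _ (hAfin p.1), mul_comm]
  · intro p _ p' _ hne
    rw [Function.onFun, Finset.disjoint_left]
    rintro ⟨d, g⟩ h1 h2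
    simp only [Finset.mem_product, Set.Finite.mem_toFinset, Set.mem_setOf_eq] at h1 h2
    apply hne
    have e2 : p.2 = p'.2 := by have h3 := h1.1.2.symm.trans h2.1.2; exact_mod_cast h3
    exact Prod.ext (h1.2.symm.trans h2.2) e2

/-- ★★ **THE SAME IN `ℕ⟦t⟧`: `Ŵ_a(t) = W(t) · P̂(t)`** with `Ŵ_a(t) := Σ_n Card {σ ∈ Ŵ_a | λ(σ) = n} t^n` (as in row g47-#3 §5),
`W(t) := Σ_j Card {g ∈ W | ℓ_W(g) = j} t^j` and `P̂(t) := Σ_k Card {d ∈ P(Φ) | μ(d) = k} t^k` — the Poincaré series of the weight lattice «viewed as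
a subgroup of» `Ŵ_a`. [cite: IwahoriMatsumoto1965, §1.10 ("P(DW, t) = … = P(W, t) Σ_{τ∈Θ′(w)} t^{λ(τ)}")] [cite: Humphreys1990, §8.9] -/
theorem mk_ncard_extendedAffineWeylGroup_eq_mul :
    PowerSeries.mk (fun n ↦ {σ : M ≃ᵃ[K] M | σ ∈ extendedAffineWeylGroup P ∧ ∃ k : ι → ℤ,
        σ '' {x : M | ∀ i, b.IsPos i → 0 < P.coroot' i x ∧ P.coroot' i x < 1} = alcove P k ∧
          ∑ i, |k i - (if b.IsPos i then (0 : ℤ) else -1)| = 2 * n}.ncard) =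
      PowerSeries.mk (fun j ↦ {g : P.weylGroup |
          PreCoxeterSystem.length (fun j : b.support ↦ RootPairing.weylGroup.ofIdx P (j : ι)) g = j}.ncard) *
        PowerSeries.mk (fun k ↦ {d : M | d ∈ weightLattice P ∧ ∃ m : ι → ℤ, (∀ i, P.coroot' i d = m i) ∧
          ∑ i ∈ Finset.univ.filter b.IsPos, (if m i ≤ 0 then |m i| else |m i| - 1) = k}.ncard) := by
  ext n
  rw [coeff_mk, coeff_mul, ncard_extendedAffineWeylGroup_sep_eq_sum b hη n]
  simp only [coeff_mk]

/-- ★★ … and with `W(t)` the Poincaré series (p13) of any Coxeter system `csW` on `W` whose simple reflections are the `s_j`: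
`Ŵ_a(t) = W(t) · P̂(t)`. [cite: IwahoriMatsumoto1965, §1.10 ("P(W, t) = Σ_{w′∈W} t^{n(w′)}")] [cite: Humphreys1990, §8.9] -/
theorem mk_ncard_extendedAffineWeylGroup_eq_poincareSeries_mul {MW : CoxeterMatrix b.support} (csW : CoxeterSystem MW P.weylGroup)
    (hcsW : ∀ j : b.support, csW.simple j = RootPairing.weylGroup.ofIdx P (j : ι)) :
    PowerSeries.mk (fun n ↦ {σ : M ≃ᵃ[K] M | σ ∈ extendedAffineWeylGroup P ∧ ∃ k : ι → ℤ,
        σ '' {x : M | ∀ i, b.IsPos i → 0 < P.coroot' i x ∧ P.coroot' i x < 1} = alcove P k ∧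
          ∑ i, |k i - (if b.IsPos i then (0 : ℤ) else -1)| = 2 * n}.ncard) =
      poincareSeries csW ℕ (Set.univ : Set P.weylGroup) *
        PowerSeries.mk (fun k ↦ {d : M | d ∈ weightLattice P ∧ ∃ m : ι → ℤ, (∀ i, P.coroot' i d = m i) ∧
          ∑ i ∈ Finset.univ.filter b.IsPos, (if m i ≤ 0 then |m i| else |m i| - 1) = k}.ncard) := by
  have h1 : csW.simple = fun j : b.support ↦ RootPairing.weylGroup.ofIdx P (j : ι) := funext hcsW
  rw [mk_ncard_extendedAffineWeylGroup_eq_mul b hη]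
  congr 1
  ext j
  rw [coeff_mk, coeff_poincareSeries_univ, Nat.cast_id]
  congr 1
  ext g
  rw [Set.mem_setOf_eq, Set.mem_setOf_eq, ← length_simple_eq csW, h1]

end ExtendedSeries

/-! ## §5 «`P(DW, t) = |Ω|·P(D'W, t)`» on the lattices: `Σ_{d∈P(Φ)} t^{μ(d)} = |Ω| · Σ_{d∈Q} t^{μ(d)}` -/

section Lattices

variable [Nonempty ι] [DecidablePred b.IsPos] [P.IsRootSystem] {η : ι}
  (hη : ∀ k, P.coroot η - P.coroot k ∈ AddSubmonoid.closure (P.coroot '' (b.support : Set ι)))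

/-- Cancelling a power series with constant term `1` over `ℕ` (through `ℤ⟦t⟧`, where it is a unit). [cite: Humphreys1990, §5.12 ("W(t) = W_I(t) W^I(t)")] -/
private theorem eq_of_mul_eq_mul_of_constantCoeff_eq_one {f g h : PowerSeries ℕ} (hf : constantCoeff f = 1) (hfg : f * g = f * h) : g = h := by
  have h1 := congrArg (PowerSeries.map (Nat.castRingHom ℤ)) hfg
  rw [map_mul, map_mul] at h1
  have hu : IsUnit (PowerSeries.map (Nat.castRingHom ℤ) f) := by
    rw [isUnit_iff_constantCoeff, ← coeff_zero_eq_constantCoeff_apply, coeff_map, coeff_zero_eq_constantCoeff_apply, hf, map_one]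
    exact isUnit_one
  exact PowerSeries.map_injective (Nat.castRingHom ℤ) Nat.cast_injective (hu.mul_left_cancel h1)

include hη

/-- ★★ **`Card {d ∈ P(Φ) | μ(d) = k} = |Ω| · Card {d ∈ Q | μ(d) = k}`** — IM's «`P(DW, t) = |Ω|·P(D'W, t)` where `|Ω|` is the order of `Ω`» read
on the two lattice series: `Ŵ_a(t) = W(t)·P̂(t)` (§4), `Ŵ_a(t) = |Ω|·W_a(t)` and `W_a(t) = W(t)·Σ_{d∈Q} t^{μ(d)}` (row g47-#3, for the Coxeter
systems of rows g45-#1 and g36 on `W_a` and `W`, which exist), and `W(t)` has constant term `1`, so it cancels; `Ω` is the stabiliser of `A∘` in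
`Ŵ_a` (its `Nat.card`; `= [P(Φ) : Q] = |det C|`, rows g45-#10, g47-#6). [cite: IwahoriMatsumoto1965, §1.10 ("P(DW, t) = |Ω|·P(D′W, t) where |Ω| is the order of Ω")] [cite: Humphreys1990, §8.9] -/
theorem ncard_weightLattice_sum_min_eq_mul (k : ℕ) :
    {d : M | d ∈ weightLattice P ∧ ∃ m : ι → ℤ, (∀ i, P.coroot' i d = m i) ∧
        ∑ i ∈ Finset.univ.filter b.IsPos, (if m i ≤ 0 then |m i| else |m i| - 1) = k}.ncard =
      Nat.card {o : M ≃ᵃ[K] M // o ∈ extendedAffineWeylGroup P ∧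
          o '' {x : M | ∀ i, b.IsPos i → 0 < P.coroot' i x ∧ P.coroot' i x < 1} =
            {x : M | ∀ i, b.IsPos i → 0 < P.coroot' i x ∧ P.coroot' i x < 1}} *
        {d : M | d ∈ P.rootSpan ℤ ∧ ∃ m : ι → ℤ, (∀ i, P.coroot' i d = m i) ∧
          ∑ i ∈ Finset.univ.filter b.IsPos, (if m i ≤ 0 then |m i| else |m i| - 1) = k}.ncard := by
  classical
  obtain ⟨cs, hcs⟩ := exists_coxeterSystem_affineWeylGroup b hη
  obtain ⟨csW, hcsW⟩ := exists_coxeterSystem_weylGroup b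
  -- `W(t)·P̂(t) = Ŵ_a(t) = |Ω|·W_a(t) = |Ω|·W(t)·Q̂(t) = W(t)·(|Ω|·Q̂(t))`
  have h1 := mk_ncard_extendedAffineWeylGroup_eq_poincareSeries_mul b hη csW hcsW
  rw [mk_ncard_extendedAffineWeylGroup_eq_smul b cs hcs hη, poincareSeries_affineWeylGroup_eq_mul b cs hcs hη ℕ csW hcsW,
    ← mul_smul_comm] at h1
  -- `W(t)` has constant term `1`
  have h0 : constantCoeff (poincareSeries csW ℕ (Set.univ : Set P.weylGroup)) = 1 := by
    rw [← coeff_zero_eq_constantCoeff_apply, coeff_poincareSeries_univ, Nat.cast_id]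
    have : {w : P.weylGroup | csW.length w = 0} = {1} := by
      ext w
      rw [Set.mem_setOf_eq, Set.mem_singleton_iff, csW.length_eq_zero_iff]
    rw [this, Set.ncard_singleton]
  have h2 := congrArg (coeff k) (eq_of_mul_eq_mul_of_constantCoeff_eq_one h0 h1.symm)
  rw [coeff_mk, map_nsmul, coeff_poincareSeries_quotient_eq_ncard b cs hcs hη, Nat.cast_id, smul_eq_mul] at h2
  exact h2

end Lattices

end Base

end Literature.LinearAlgebra.RootSystem
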